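import Literature.MathematicalPhysics.QuantumFieldTheory.Balaban1983to89.B10Eq71TorusOverlap
import Literature.MathematicalPhysics.QuantumFieldTheory.Balaban1983to89.B15Eq177GaugeInvariance
import Literature.MathematicalPhysics.QuantumFieldTheory.Balaban1983to89.B15Prop1Thm1GeneralFormAtZSequence
import Literature.MathematicalPhysics.QuantumFieldTheory.Balaban1983to89.Node00.Record13CoPH

/-!
# DAG node N11 — THE p. 263 POINT COUNT OF [III] THEOREM 2 AT THE ₁₃ OBJECTS: «|Γ_n∩Ω| means the number of points in the set Γ_n∩Ω ⊂ T₁^{(n)}» — the number of points of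
# `T₁^{(j)}` lying in an `n`-BLOCK UNION `X ⊂ T_η` is EXACTLY `(L^d)^{n−j}` times the number of points of `T₁^{(n)}` in `X` (kernel theorem), hence the count binder
# `hcount` of this seat's (2.43)∕(2.44)-at-the-record files ⟸ «`Γ_n(s)` is a union of `n`-blocks» (NODE 00 geometry of the (2.18) history)

Cell `pub-ymgap`, YM-PLAN Track A (HUMAN RULING D-0062 ∕ D-0149), seat `pub-ymgap-dag-n11-w2` (g0), route `BalabanUVNodes`, key item K1⁷ `StabilityBAtRecordR13SepCoPH` =
stmt-QuantumFields-20542 (helper, count-neutral).  Companion of this seat's `…Thm2ESideAtRecord13CoPH` ∕ `…Thm2RSideAtRecord13CoPH` ∕ `…OfSect3Sentences`, whose binders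
`hcount`∕`hcountE`∕`hcountR` read «at most `(L^{n−j})⁴·Γ_n` points (cubes) of scale `n`» (p. 263: the z-sum of (2.43) has `(L^{n−j})⁴|Γ_n∩Ω|` points of `T₁^{(j)}` per unit
`n`-volume).  [III] = [Balaban1988Convergent], [I] = [Balaban1987RG1].

WHY THIS FILE.  In the tree: the iterated centre embedding `toFine j = embIter j : T₁^{(j)} → T_η` ([I] (0.1) p. 251, `B10Eq71TorusOverlap.toFine_eq_embIter`), the iterated block map
`blockIter`, the `j`-BLOCK-UNION predicate `B14.Eq22Determines.IsBlockUnion j X := ∀ x, x ∈ X ↔ embIter j (blockIter j x) ∈ X`, the block count `Site.card_block` (`|B(y)| = L^d`) and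
`B10StarCount.card_blockSet` (`|B(Λ)| = L^d|Λ|`), `B15Eq177GaugeInvariance.blockIter_embIter`.  Not in the tree: the COUNT of scale-`j` points inside an `n`-block union.  THIS FILE proves it
and reads it as the p. 263 count at the objects of record: for the (2.2) region `Γ_n(s) = gammaRegion s.Ω k n` of a (2.18) history, which IS an `n`-block union (a difference of members of `𝐃_n`, `𝐃_{n+1}` — unions of torus cubes whose sides are multiples of `Lⁿ`; proved in §1b through `isBlockUnion_of_isUnionOfCubes_cover`),
every finite set of scale-`j` points mapped into `Γ_n(s)` by a scale assignment has at most `(L^{n−j})⁴·|Γ_n(s)|` members of scale `n` — the letter of `hcountE`; and the block-union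
structure of `Γ_n(s)` is itself PROVED here from the (2.1) admissibility of the history (members of `𝐃_n`, `𝐃_{n+1}` have sides `Lⁿ·M·R_n`, `L^{n+1}·M·R_{n+1}`, multiples of `Lⁿ`).

WHAT THIS FILE PROVES (0 `sorry`, 0 `def`, standard axioms; count-neutral; pure lattice bookkeeping — nothing of Bałaban's asserted).
§1 generic torus (`P : Params`, standing range `n ≤ m + K`): `blockIter_rep_of_le` (`blockIter n (embIter m (blockIter m x)) = blockIter n x`, m ≤ n) · `isBlockUnion_of_le` (an `n`-block union is
an `m`-block union, m ≤ n) · `filter_toFine_mem_eq_blockSet` (the scale-`i` points in an `(i+1)`-block union are the blocks of the scale-`(i+1)` points in it) · ★ `card_filter_toFine_mem`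
(`#{z ∈ T₁^{(j)} : z ∈ X} = (L^d)^{n−j} · #{y ∈ T₁^{(n)} : y ∈ X}` for an `n`-block union `X`, j ≤ n).
§1b `mem_alignedBox_iff` · `isUnionOfCubes_preimage_cubeEnl` (the cover-preimage of a torus cube of side `s` is a union of `t`-cubes of `ℤᵈ` when `t ∣ s` and `t ∣ 2L^{m+K}`) ·
★ `isBlockUnion_of_mem_unionsOfCubes` (every member of `unionsOfCubes P s` with `Lⁿ ∣ s` is an `n`-block union, via `isBlockUnion_of_isUnionOfCubes_cover`) · `isBlockUnion_diff` ·
`isBlockUnion_empty` · ★★ `isBlockUnion_gammaRegion` (`Γ_n(s)` of a (2.18) history of record is an `n`-block union, from the (2.1) admissibility `Chain21.memΩ` alone) ·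
`exists_scale_of_mem_Omega` ∕ `exists_scale_of_admE` (every point of `Ω_j(s)`, in particular every point of the (2.26)–(2.27) range, has a scale `n ∈ [j,k]` with `x ∈ Γ_n(s)`).
§2 at the ₁₃ objects (`d = 4`): `hcount_at_record₁₃_of_isBlockUnion` (the count from a displayed block-union fact) and ★★★ `hcount_at_record₁₃` — for a history `s`, scales
`1 ≤ j ≤ n ≤ m + K`, ANY finite point set `Z ⊂ T₁^{(j)}` and ANY scale map `sc` sending its scale-`n` points into `Γ_n(s)` (`hsc`): `#{z ∈ Z : sc z = n} ≤ (L^{n−j})⁴ · |Γ_n(s)|` with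
`|Γ_n(s)| := #{y ∈ T₁^{(n)} : y ∈ Γ_n(s)}`, NO geometric hypothesis — the `hcountE` binder of `…Thm2ESideAtRecord13CoPH` ∕ `…OfSect3Sentences` at `L := (F.P p.K).L`, `Γ n := |Γ_n(s)|`
is a THEOREM of the record.

HONEST FRAMING.  Lattice combinatorics; N11 NOT discharged; K1⁷ NOT closed; counts unmoved (typed 28∕28 · discharged 5∕27).  One finite four-torus programme at fixed `ε = L^{−K}`; R4 closes
only the conditional finite-𝕋⁴ rung `BalabanLadder.UV`; NOT ℝ⁴, NOT OS, NOT a mass gap, NOT Clay.  Sources: [III] p. 263 (after (2.43)), (2.2) p. 255; [I] (0.1)–(0.3) pp. 251–252.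
-/

noncomputable section

open scoped BigOperators

namespace Summit.QuantumFields.YangMills.Theorems.BalabanUVNodesN11Thm2PointCountAtRecord13CoPH

open Literature.MathematicalPhysics.QuantumFieldTheory.Balaban1983to89 Finset
open B15DeterminingSets (embIter gammaRegion)
open B14.Eq22Determines (blockIter IsBlockUnion blockIter_succ)
open B10Eq38TorusDomains (toFine)
open B10Eq71TorusOverlap (toFine_eq_embIter)
open B15Eq177GaugeInvariance (blockIter_embIter)
open B10StarCount (blockSet mem_blockSet card_blockSet)
open B14DomainGeom (Pt IsUnionOfCubes cubeIdx)
open B14.Eq213MaximalDomains (cubeExt)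
open B15Eq112TorusCover (cover lift per per_apply cover_lift cover_eq_cover_iff cover_add_pmul)
open B15LatticeCubeTorus (pmul)
open B15Prop1Thm1GeneralFormAtZSequence (isBlockUnion_of_isUnionOfCubes_cover)
open T4Continuum
open Node00 hiding blockIter

/-! ## §1. Scale-`j` points in an `n`-block union -/

section Torus

variable {P : Params}

/-- `blockIter n ∘ (embIter m ∘ blockIter m) = blockIter n` for `m ≤ n` (the representative point of the `m`-block has the same `n`-block). [cite: Balaban1987RG1, (0.1)–(0.3) pp.251–252 (bookkeeping)] -/
theorem blockIter_rep_of_le {m n : ℕ} (hmn : m ≤ n) (hm : m ≤ P.m + P.K) (x : Site P 0) :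
    blockIter n (embIter m (blockIter m x)) = blockIter n x := by
  induction n, hmn using Nat.le_induction with
  | base => exact blockIter_embIter m hm _
  | succ n hmn ih => rw [blockIter_succ, blockIter_succ, ih]

/-- **An `n`-block union is an `m`-block union for every `m ≤ n`** (blocks nest). [cite: Balaban1987RG1, (0.1)–(0.3) pp.251–252 (bookkeeping)] -/
theorem isBlockUnion_of_le {m n : ℕ} (hmn : m ≤ n) (hm : m ≤ P.m + P.K) {X : Set (Site P 0)} (hX : IsBlockUnion n X) : IsBlockUnion m X := by
  intro x
  rw [hX x, hX (embIter m (blockIter m x)), blockIter_rep_of_le hmn hm]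

/-- **The scale-`i` points in an `(i+1)`-block union are the blocks of the scale-`(i+1)` points in it**: `{z ∈ T₁^{(i)} : z ∈ X} = B({y ∈ T₁^{(i+1)} : y ∈ X})`
(`z ∈ X` read through `toFine`). [cite: Balaban1987RG1, (0.1)–(0.3) pp.251–252 (bookkeeping)] -/
theorem filter_toFine_mem_eq_blockSet {i : ℕ} (hi : i + 1 ≤ P.m + P.K) {X : Set (Site P 0)} (hX : IsBlockUnion (i + 1) X)
    [DecidablePred fun z : Site P i => toFine i z ∈ X] [DecidablePred fun y : Site P (i + 1) => toFine (i + 1) y ∈ X] :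
    (univ.filter fun z : Site P i => toFine i z ∈ X) = blockSet (univ.filter fun y : Site P (i + 1) => toFine (i + 1) y ∈ X) := by
  ext z
  simp only [Finset.mem_filter, Finset.mem_univ, true_and, mem_blockSet]
  have h1 : blockIter (i + 1) (toFine i z) = blockOf z := by
    rw [blockIter_succ, toFine_eq_embIter, blockIter_embIter i (by omega)]
  have h2 : blockIter (i + 1) (toFine (i + 1) (blockOf z)) = blockOf z := by
    rw [toFine_eq_embIter, blockIter_embIter (i + 1) hi]
  rw [hX (toFine i z), hX (toFine (i + 1) (blockOf z)), h1, h2]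

/-- **★ THE COUNT**: for an `n`-block union `X ⊂ T_η` and `j ≤ n ≤ m + K`, `#{z ∈ T₁^{(j)} : z ∈ X} = (L^d)^{n−j} · #{y ∈ T₁^{(n)} : y ∈ X}` — «(L^{n−j})^d points of T₁^{(j)} per point of
T₁^{(n)}», the arithmetic behind p. 263's count. [cite: Balaban1988Convergent, p.263 (after (2.43)); Balaban1987RG1, (0.1)–(0.3) pp.251–252] -/
theorem card_filter_toFine_mem {j n : ℕ} (hjn : j ≤ n) (hn : n ≤ P.m + P.K) {X : Set (Site P 0)} (hX : IsBlockUnion n X)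
    [∀ i, DecidablePred fun z : Site P i => toFine i z ∈ X] :
    (univ.filter fun z : Site P j => toFine j z ∈ X).card = (P.L ^ P.d) ^ (n - j) * (univ.filter fun y : Site P n => toFine n y ∈ X).card := by
  induction n, hjn using Nat.le_induction with
  | base => simp
  | succ n hjn ih =>
    have hXn : IsBlockUnion n X := isBlockUnion_of_le (Nat.le_succ n) (by omega) hX
    have hstep : (univ.filter fun z : Site P n => toFine n z ∈ X).card =
        P.L ^ P.d * (univ.filter fun y : Site P (n + 1) => toFine (n + 1) y ∈ X).card := by
      rw [filter_toFine_mem_eq_blockSet hn hX, card_blockSet hn]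
    rw [ih (by omega) hXn, hstep, show n + 1 - j = (n - j) + 1 by omega, pow_succ]
    ring

end Torus

/-! ## §1b. Members of the cube classes `unionsOfCubes P s`, `Lⁿ ∣ s`, are `n`-block unions; hence so is `Γ_n(s)` of a (2.18) history of record -/

section Cubes

variable {P : Params}

/-- An aligned integer box is a union of `t`-cubes: for `0 < t`, `t ∣ c`, `t ∣ w`, `c ≤ x ≤ c + w − 1 ↔ c∕t ≤ x∕t < (c + w)∕t`. [folklore] -/
theorem mem_alignedBox_iff {t c w x : ℤ} (ht : 0 < t) (hc : t ∣ c) (hw : t ∣ w) :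
    (c ≤ x ∧ x ≤ c + w - 1) ↔ (c / t ≤ x / t ∧ x / t < (c + w) / t) := by
  obtain ⟨c', rfl⟩ := hc
  obtain ⟨w', rfl⟩ := hw
  rw [show t * c' + t * w' = t * (c' + w') by ring, Int.mul_ediv_cancel_left _ ht.ne', Int.mul_ediv_cancel_left _ ht.ne']
  constructor
  · rintro ⟨h1, h2⟩
    refine ⟨?_, ?_⟩
    · have := Int.ediv_le_ediv ht h1
      rwa [Int.mul_ediv_cancel_left _ ht.ne'] at this
    · rw [Int.ediv_lt_iff_lt_mul ht]; linarith
  · rintro ⟨h1, h2⟩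
    refine ⟨?_, ?_⟩
    · have h3 := Int.ediv_mul_le x ht.ne'
      have h4 : t * c' ≤ x / t * t := by nlinarith
      linarith
    · rw [Int.ediv_lt_iff_lt_mul ht] at h2; linarith

/-- **The cover-preimage of ONE torus cube of side `s` is a union of `t`-cubes of `ℤᵈ`** whenever `t ∣ s` and `t` divides the torus period `2L^{m+K}` (deck translates of an
aligned box are aligned boxes). [cite: Balaban1988Convergent, (2.1) p.254; Balaban1987RG1, (0.1) p.251 (bookkeeping)] -/
theorem isUnionOfCubes_preimage_cubeEnl {t s : ℕ} (ht : 0 < t) (hts : t ∣ s) (hper : t ∣ P.sitesPerDir 0) (a : Pt P.d) :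
    IsUnionOfCubes t (cover P ⁻¹' cubeEnl P s a 0) := by
  have ht' : (0 : ℤ) < (t : ℤ) := by exact_mod_cast ht
  -- membership: `x ∈ π⁻¹(π '' C) ↔ ∃ v, x - per·v ∈ C`
  have hmem : ∀ x : Pt P.d, x ∈ cover P ⁻¹' cubeEnl P s a 0 ↔ ∃ v : Pt P.d, ∀ i,
      (s : ℤ) * a i + (P.sitesPerDir 0 : ℤ) * v i ≤ x i ∧ x i ≤ (s : ℤ) * a i + (P.sitesPerDir 0 : ℤ) * v i + s - 1 := by
    intro x
    simp only [Set.mem_preimage, cubeEnl, Set.mem_image, zero_mul, Nat.cast_zero]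
    constructor
    · rintro ⟨z, hz, hzx⟩
      obtain ⟨v, hv⟩ := (cover_eq_cover_iff z x).1 hzx
      refine ⟨v, fun i => ?_⟩
      have h := hz i
      have hvi : x i = z i + (P.sitesPerDir 0 : ℤ) * v i := by rw [hv]; simp [pmul]
      constructor <;> linarith [h.1, h.2]
    · rintro ⟨v, hv⟩
      refine ⟨x - pmul (per P) v, fun i => ?_, ?_⟩
      · have h := hv i
        simp only [Pi.sub_apply, pmul, per_apply]
        constructor <;> linarith [h.1, h.2]
      · have h := cover_add_pmul (P := P) (x - pmul (per P) v) v
        rw [sub_add_cancel] at h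
        exact h.symm
  intro x y hxy
  rw [hmem x, hmem y]
  have key : ∀ (x y : Pt P.d), cubeIdx t x = cubeIdx t y → ∀ v : Pt P.d, (∀ i,
      (s : ℤ) * a i + (P.sitesPerDir 0 : ℤ) * v i ≤ x i ∧ x i ≤ (s : ℤ) * a i + (P.sitesPerDir 0 : ℤ) * v i + s - 1) →
      ∀ i, (s : ℤ) * a i + (P.sitesPerDir 0 : ℤ) * v i ≤ y i ∧ y i ≤ (s : ℤ) * a i + (P.sitesPerDir 0 : ℤ) * v i + s - 1 := by
    intro x y hxy v hx i
    have hc : (t : ℤ) ∣ (s : ℤ) * a i + (P.sitesPerDir 0 : ℤ) * v i :=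
      dvd_add (dvd_mul_of_dvd_left (Int.natCast_dvd_natCast.2 hts) _) (dvd_mul_of_dvd_left (Int.natCast_dvd_natCast.2 hper) _)
    have hs : (t : ℤ) ∣ (s : ℤ) := Int.natCast_dvd_natCast.2 hts
    have hxi := (mem_alignedBox_iff ht' hc hs).1 (hx i)
    have hi : x i / (t : ℤ) = y i / (t : ℤ) := congrFun hxy i
    rw [hi] at hxi
    exact (mem_alignedBox_iff ht' hc hs).2 hxi
  constructor
  · rintro ⟨v, hv⟩; exact ⟨v, key x y hxy v hv⟩
  · rintro ⟨v, hv⟩; exact ⟨v, key y x hxy.symm v hv⟩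

/-- **Every member of the cube class `unionsOfCubes P s` is an `n`-BLOCK UNION when `Lⁿ ∣ s`** (standing range `n ≤ m + K`; `Lⁿ` divides the period `2L^{m+K}`): finite unions of
the cubes above, read through `isBlockUnion_of_isUnionOfCubes_cover`. [cite: Balaban1988Convergent, (2.1) p.254; Balaban1987RG1, (0.1) p.251] -/
theorem isBlockUnion_of_mem_unionsOfCubes {n s : ℕ} (hn : n ≤ P.m + P.K) (hs : P.L ^ n ∣ s) {Z : Set (Site P 0)} (hZ : Z ∈ unionsOfCubes P s) :
    IsBlockUnion n Z := by
  obtain ⟨A, -, rfl⟩ := hZ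
  have ht : 0 < P.L ^ n := pow_pos P.L_pos n
  have hper : P.L ^ n ∣ P.sitesPerDir 0 := by
    unfold Params.sitesPerDir
    exact Dvd.dvd.mul_left (pow_dvd_pow P.L (by omega)) 2
  refine isBlockUnion_of_isUnionOfCubes_cover hn (dvd_refl _) ?_
  intro x y hxy
  simp only [Set.mem_preimage, Set.mem_iUnion]
  constructor
  · rintro ⟨a, ha, hx⟩
    exact ⟨a, ha, ((isUnionOfCubes_preimage_cubeEnl ht hs hper a) x y hxy).1 hx⟩
  · rintro ⟨a, ha, hy⟩
    exact ⟨a, ha, ((isUnionOfCubes_preimage_cubeEnl ht hs hper a) x y hxy).2 hy⟩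

/-- Block unions are closed under set difference. [cite: Balaban1987RG1, (0.1)–(0.3) pp.251–252 (bookkeeping)] -/
theorem isBlockUnion_diff {n : ℕ} {X Y : Set (Site P 0)} (hX : IsBlockUnion n X) (hY : IsBlockUnion n Y) : IsBlockUnion n (X \ Y) := by
  intro x
  change x ∈ X ∧ x ∉ Y ↔ embIter n (blockIter n x) ∈ X ∧ embIter n (blockIter n x) ∉ Y
  rw [← hX x, ← hY x]

/-- The empty set is a block union. [folklore] -/
theorem isBlockUnion_empty (n : ℕ) : IsBlockUnion n (∅ : Set (Site P 0)) := fun _ => by simp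

end Cubes

section GammaRegion

variable {F : T4Family} {N : ℕ} [NeZero N]
variable (θ : Stage13HParams F N) (p : B12.RunParams) {k : ℕ}

/-- **`Γ_n(s)` OF A (2.18) HISTORY OF RECORD IS AN `n`-BLOCK UNION** (`1 ≤ n`, `n ≤ m + K`): `Ω_n(s) ∈ 𝐃_n` (cubes of side `Lⁿ·M·R_n`) and `Ω_{n+1}(s) ∈ 𝐃_{n+1}` (side `L^{n+1}·M·R_{n+1}`) by
the admissibility (2.1) of the history (`Chain21.memΩ`; off the window `Ω = ∅`), and `Γ_n = Ω_n∖Ω_{n+1}` ∕ `Ω_k` ∕ `∅` by (2.2). [cite: Balaban1988Convergent, (2.1)–(2.2) pp.254–255] -/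
theorem isBlockUnion_gammaRegion (s : SeqOfRecord F θ.ν θ.τ9.M (gOfRecord₁₃ F N θ.toStage13Params p) p.K k) {n : ℕ} (h1 : 1 ≤ n)
    (hn : n ≤ (F.P p.K).m + (F.P p.K).K) : IsBlockUnion n (gammaRegion s.Ω k n) := by
  have hΩmem : ∀ i, 1 ≤ i → n ≤ i → i ≤ (F.P p.K).m + (F.P p.K).K + 1 → IsBlockUnion n (s.Ω i) := by
    intro i hi hni _
    by_cases hik : i ≤ k
    · have hmem : s.Ω i ∈ DOfRecord F θ.ν θ.τ9.M (gOfRecord₁₃ F N θ.toStage13Params p) p.K i := s.chain.memΩ i hi hik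
      refine isBlockUnion_of_mem_unionsOfCubes hn ?_ hmem
      unfold dCubeSide
      exact Dvd.dvd.mul_right (Dvd.dvd.mul_right (pow_dvd_pow _ hni) _) _
    · rw [s.Ω_off i (fun h => hik h.2)]
      exact isBlockUnion_empty n
  unfold gammaRegion
  by_cases hkn : k < n
  · rw [if_pos hkn]; exact isBlockUnion_empty n
  rw [if_neg hkn]
  by_cases hnk : n = k
  · rw [if_pos hnk]; exact hΩmem k (by omega) (by omega) (by omega)
  rw [if_neg hnk, if_neg (by omega : n ≠ 0)]
  exact isBlockUnion_diff (hΩmem n h1 le_rfl (by omega)) (hΩmem (n + 1) (by omega) (by omega) (by omega))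


/-- **EVERY POINT OF `Ω_j(s)` HAS A SCALE**: for `1 ≤ j ≤ k` and `x ∈ Ω_j(s)` there is `n ∈ [j, k]` with `x ∈ Γ_n(s)` (the largest `n` with `x ∈ Ω_n(s)`; (2.1): `Ω_{n+1} ⊆ Λ_n ⊆ Ω_n`) — the scale map
the p. 263 count is taken against («z ∈ Λ_j⁰ ∩ (Ω_n∖Ω_{n+1})»). [cite: Balaban1988Convergent, (2.1)–(2.2) pp.254–255, p.263] -/
theorem exists_scale_of_mem_Omega (s : SeqOfRecord F θ.ν θ.τ9.M (gOfRecord₁₃ F N θ.toStage13Params p) p.K k) {j : ℕ} (hj : 1 ≤ j) (hjk : j ≤ k)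
    {x : Site (F.P p.K) 0} (hx : x ∈ s.Ω j) : ∃ n, j ≤ n ∧ n ≤ k ∧ x ∈ gammaRegion s.Ω k n := by
  -- induction on the number of scales above `j`
  suffices H : ∀ t j, j + t = k → 1 ≤ j → x ∈ s.Ω j → ∃ n, j ≤ n ∧ n ≤ k ∧ x ∈ gammaRegion s.Ω k n from
    H (k - j) j (by omega) hj hx
  intro t
  induction t with
  | zero =>
    intro j hjt hj hx
    refine ⟨j, le_rfl, by omega, ?_⟩
    rw [show j = k by omega, B15DeterminingSets.gammaRegion_self]
    rw [show j = k by omega] at hx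
    exact hx
  | succ t ih =>
    intro j hjt hj hx
    by_cases hx' : x ∈ s.Ω (j + 1)
    · obtain ⟨n, hn1, hn2, hn3⟩ := ih (j + 1) (by omega) (by omega) hx'
      exact ⟨n, by omega, hn2, hn3⟩
    · exact ⟨j, le_rfl, by omega, by rw [B15DeterminingSets.gammaRegion_mid s.Ω (by omega) (by omega)]; exact ⟨hx, hx'⟩⟩

/-- **THE POINTS OF THE (2.26)–(2.27) RANGE HAVE SCALES**: if `admE … s.Λ j (domSites X) z` holds then `toFine j z ∈ Λ_j(s) ⊆ Ω_j(s)`, hence `toFine j z ∈ Γ_n(s)` for some `n ∈ [j, k]` —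
so the support `Z_j` of the 𝐄-side carries a scale map as the count requires. [cite: Balaban1988Convergent, (2.26)–(2.27) p.259, (2.1)–(2.2) pp.254–255] -/
theorem exists_scale_of_admE (s : SeqOfRecord F θ.ν θ.τ9.M (gOfRecord₁₃ F N θ.toStage13Params p) p.K k) {j : ℕ} (hj : 1 ≤ j) (hjk : j ≤ k)
    {X : (Sect2.domSys (F.P p.K) θ.τ9.M j).Dom} {z : Site (F.P p.K) j}
    (h : Sect2.admE (F.P p.K) θ.ν θ.τ9.M (gOfRecord₁₃ F N θ.toStage13Params p) s.Λ j (Sect2.domSites (F.P p.K) θ.τ9.M j X) z = true) :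
    ∃ n, j ≤ n ∧ n ≤ k ∧ toFine j z ∈ gammaRegion s.Ω k n := by
  obtain ⟨-, hzX, hXΛ⟩ := (Sect2.admE_eq_true_iff θ.ν θ.τ9.M _ s.Λ j _ z).1 h
  exact exists_scale_of_mem_Omega θ p s hj hjk (s.chain.Λ_subset j hj hjk (hXΛ hzX))

end GammaRegion

/-! ## §2. At the ₁₃ objects: the `hcount` binder from the block-union structure of `Γ_n(s)` -/

section AtRecord13

variable {F : T4Family} {N : ℕ} [NeZero N]
variable (θ : Stage13HParams F N) (p : B12.RunParams) {k : ℕ}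

/-- **★★ THE p. 263 COUNT AT THE RECORD**: for a (2.18) history `s` of the run `p`, scales `j ≤ n` with `n ≤ m + K` (standing range), a finite set `Z` of points of `T₁^{(j)}` with a scale map
`sc` whose scale-`n` members lie in `Γ_n(s) = gammaRegion s.Ω k n` (`hsc`: «z ∈ Λ_j⁰ ∩ (Ω_n∖Ω_{n+1})»), and `Γ_n(s)` an `n`-block union (`hblk`, NODE 00 geometry): `#{z ∈ Z : sc z = n} ≤
(L^{n−j})⁴ · |Γ_n(s)|`, `|Γ_n(s)| := #{y ∈ T₁^{(n)} : y ∈ Γ_n(s)}` — the `hcountE` binder of `…Thm2ESideAtRecord13CoPH` ∕ `…OfSect3Sentences` at `L := (F.P p.K).L`.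
[cite: Balaban1988Convergent, p.263 (after (2.43)), (2.2) p.255] -/
theorem hcount_at_record₁₃_of_isBlockUnion (s : SeqOfRecord F θ.ν θ.τ9.M (gOfRecord₁₃ F N θ.toStage13Params p) p.K k) {j n : ℕ} (hjn : j ≤ n)
    (hn : n ≤ (F.P p.K).m + (F.P p.K).K) (hblk : IsBlockUnion n (gammaRegion s.Ω k n))
    [∀ i, DecidablePred fun z : Site (F.P p.K) i => toFine i z ∈ gammaRegion s.Ω k n]
    (Z : Finset (Site (F.P p.K) j)) (sc : Site (F.P p.K) j → ℕ) (hsc : ∀ z ∈ Z, sc z = n → toFine j z ∈ gammaRegion s.Ω k n) :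
    ((Z.filter fun z => sc z = n).card : ℝ) ≤
      (((F.P p.K).L : ℝ) ^ ((n : ℝ) - j)) ^ (4 : ℝ) * ((univ.filter fun y : Site (F.P p.K) n => toFine n y ∈ gammaRegion s.Ω k n).card : ℝ) := by
  classical
  have hsub : (Z.filter fun z => sc z = n) ⊆ (univ.filter fun z : Site (F.P p.K) j => toFine j z ∈ gammaRegion s.Ω k n) := by
    intro z hz
    rw [Finset.mem_filter] at hz ⊢
    exact ⟨Finset.mem_univ _, hsc z hz.1 hz.2⟩
  have hcard := Finset.card_le_card hsub
  rw [card_filter_toFine_mem hjn hn hblk, T4Family.P_d] at hcard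
  have e4 : (((F.P p.K).L : ℝ) ^ ((n : ℝ) - j)) ^ (4 : ℝ) = (((F.P p.K).L : ℝ) ^ ((n : ℝ) - j)) ^ 4 := by
    exact_mod_cast Real.rpow_natCast (((F.P p.K).L : ℝ) ^ ((n : ℝ) - j)) 4
  have e2 : ((F.P p.K).L : ℝ) ^ ((n : ℝ) - j) = ((F.P p.K).L : ℝ) ^ (n - j) := by
    rw [← Nat.cast_sub hjn, Real.rpow_natCast]
  rw [e4, e2]
  calc ((Z.filter fun z => sc z = n).card : ℝ)
      ≤ ((((F.P p.K).L ^ 4) ^ (n - j) * (univ.filter fun y : Site (F.P p.K) n => toFine n y ∈ gammaRegion s.Ω k n).card : ℕ) : ℝ) := by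
        exact_mod_cast hcard
    _ = (((F.P p.K).L : ℝ) ^ (n - j)) ^ 4 * ((univ.filter fun y : Site (F.P p.K) n => toFine n y ∈ gammaRegion s.Ω k n).card : ℝ) := by
        push_cast
        ring

/-- **★★★ THE p. 263 COUNT AT THE RECORD, NO GEOMETRIC HYPOTHESIS LEFT**: for a (2.18) history `s` of the run `p`, scales `1 ≤ j ≤ n ≤ m + K`, any finite set `Z ⊂ T₁^{(j)}` and
any scale map `sc` sending its scale-`n` members into `Γ_n(s)` («z ∈ Λ_j⁰ ∩ (Ω_n∖Ω_{n+1})», the definition of the scale of a point): `#{z ∈ Z : sc z = n} ≤ (L^{n−j})⁴·|Γ_n(s)|`,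
`|Γ_n(s)| = #{y ∈ T₁^{(n)} : y ∈ Γ_n(s)}` — the `hcountE` binder of this seat's (2.43)-at-the-record files is a THEOREM of the history's (2.1) admissibility.
[cite: Balaban1988Convergent, p.263 (after (2.43)), (2.1)–(2.2) pp.254–255] -/
theorem hcount_at_record₁₃ (s : SeqOfRecord F θ.ν θ.τ9.M (gOfRecord₁₃ F N θ.toStage13Params p) p.K k) {j n : ℕ} (hj : 1 ≤ j) (hjn : j ≤ n)
    (hn : n ≤ (F.P p.K).m + (F.P p.K).K) [∀ i, DecidablePred fun z : Site (F.P p.K) i => toFine i z ∈ gammaRegion s.Ω k n]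
    (Z : Finset (Site (F.P p.K) j)) (sc : Site (F.P p.K) j → ℕ) (hsc : ∀ z ∈ Z, sc z = n → toFine j z ∈ gammaRegion s.Ω k n) :
    ((Z.filter fun z => sc z = n).card : ℝ) ≤
      (((F.P p.K).L : ℝ) ^ ((n : ℝ) - j)) ^ (4 : ℝ) * ((univ.filter fun y : Site (F.P p.K) n => toFine n y ∈ gammaRegion s.Ω k n).card : ℝ) :=
  hcount_at_record₁₃_of_isBlockUnion θ p s hjn hn (isBlockUnion_gammaRegion θ p s (hj.trans hjn) hn) Z sc hsc

end AtRecord13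

end Summit.QuantumFields.YangMills.Theorems.BalabanUVNodesN11Thm2PointCountAtRecord13CoPH

end
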